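import Summits.QuantumFields.YangMills.Theorems.BalabanUVNodesN15KingModelAnalyticDeterminantVolumeLawEtaUniform
import Summits.QuantumFields.YangMills.Theorems.BalabanUVNodesN15KingModelAnalyticDeterminantVolumeLawDecoupling
import Summits.QuantumFields.YangMills.Theorems.BalabanUVNodesN15KingModelAnalyticDeterminantSecondOrderIntegral
import HarnessLib

/-!
# BalabanUVNodes ∕ N15 — THE KING-MODEL RUNG (PART Ϯ-m): PACKAGE — LOCALITY AND THE SECOND VARIATION OF KING's ONE-LEVEL GAUSSIAN NORMALISATIONS, BY NAME:
# (A) the VOLUME LAW (cost of a local change of the background ∝ #changed bonds, constant `c·G(0,0)`), η-UNIFORM in `d+1 = 4`, and the DECOUPLING of two distant changes (fine normalisation,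
# King's decay rate); (B) King's (3.96) at `n = 2` EXACTLY for the block-field normalisation — second derivative, two-sided curvature, Taylor with two-sided∕integral remainder, and the same
# for King's `E₀ = ln 𝒩(Δ_eff)`; (C) WHAT THE CURVED CASE ADDS, in one sentence per item
# (Track A, DAG node N15 = NE2; FAN-OUT v1.1 §N15 s3 «KING-MODEL RUNG … + what the curved case adds»; count-neutral)

HONEST FRAMING.  Count-neutral (cell `pub-ymgap`, seat `pub-ymgap-dag-n15-e` g54; `--supports stmt-QuantumFields-27247 --as helper` = K3ᴬ, KEY MAP v3).  Conjunctions of PART Ϯ-a…Ϯ-l theorems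
BY NAME plus the `ln 𝒩` edition of the second-order statement; King's one-level comparison model (Bałaban's covariant block mean on a tree contour system), `a, m² > 0`, `c ≥ 0`; `𝕜 = ℝ` where
Jacobi∕Taylor are used; `d+1 = 4`, equal periods, King's scaling `c = L²` where «η-uniform» is said.  NOT King's multi-step `Z_k(A)`; NOT (3.97)–(3.98); NOT Bałaban's (3.42); NOT a node
discharge (N15 of record untouched); nothing continuum ∕ ℝ⁴ ∕ OS ∕ Clay; count-neutral.

CONTENT.  §1 ★★★ `king_logGaussNorm_second_order` (`−½tr(C(V)E) + ¼a⁻²tr(E²) ≤ ln 𝒩(Δ_eff(U)) − ln 𝒩(Δ_eff(V)) ≤ −½tr(C(V)E) + ¼β♯⁻²tr(E²)`: King's `E₀` is CONVEX in the background operator with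
modulus in `[¼a⁻², ¼β♯⁻²]`); §2 ★★★★ **`king_second_variation_package`** (Ϯ-g∕h∕i by name); §3 ★★★★ **`king_locality_package`** (Ϯ-d∕f by name at King's scaling in `d+1 = 4`);
§4 ★★★ **`king_locality_what_the_curved_case_adds`** (at `U ≡ 1` every item is an identity `0 = 0` ∕ King's closed form; the curved case adds: deviation `O(#supp U)` η-uniformly, strict
concavity between distinct block-field operators, exponentially small interaction of distant changes).

PRIOR TREE ART (by name, not restated): Ϯ-d `abs_log_re_det_effLapU_sub_le_volume`, Ϯ-f `abs_log_re_det_effLapU_sub_le_volume_eta_uniform`∕`…closedForm…`∕`volumeConst_le`, Ϯ-l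
`abs_log_det_covLapF_decoupling`, Ϯ-g `king_second_variation_bounds`∕`king_second_variation_neg`, Ϯ-h `king396_two_sided_remainder`∕`king_response_sandwich_strong`∕`log_det_effLapU_sub_lt_re_trace`,
Ϯ-i `log_det_effLapU_sub_eq_trace_sub_integral`, Ϭ-b `log_gaussNorm_effLapU`, Ϭ-i `log_re_det_effLapU_flat`.  Dedup (rg at filing): basename 0 files;
`king_logGaussNorm_second_order|king_second_variation_package|king_locality_package|king_locality_what_the_curved_case_adds` 0 tree files.
Locators: [King1986] (2.6) p.652, (2.13)–(2.16) p.653, (3.89)–(3.90) pp.668–669, (3.94)–(3.96) p.669, (4.4)–(4.5) p.670, (4.33)∕(4.35) p.674; [Balaban1985BackgroundPropagators] (3.19) p.393,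
(3.23)–(3.25) p.394, (3.42) p.397; [Klingen1990] Ch. V §11 (15) p.141.  0 `sorry`, 0 `def`.
-/

noncomputable section

open scoped BigOperators ComplexConjugate ComplexOrder Matrix.Norms.L2Operator
open Finset Matrix Set MeasureTheory intervalIntegral

namespace Summit.QuantumFields.YangMills.BalabanUVNodes.N15KingModelRung.Analytic

open Literature.MathematicalPhysics.QuantumFieldTheory.Balaban1983to89.B5Prop11Plancherel (Tor fine unitVec)
open Literature.MathematicalPhysics.QuantumFieldTheory.Balaban1983to89.B4TorusKernel (periodConst)
open Literature.MathematicalPhysics.QuantumFieldTheory.King1986.Torus (lapF effSym tdistT)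
open Literature.MathematicalPhysics.QuantumFieldTheory.Balaban1983to89.Beta.WoodburyFibre (cM)
open Summit.QuantumFields.YangMills.BalabanUVNodes.N15KingModelRung.TorusSpectral (kappaFree)
open Summit.QuantumFields.YangMills.BalabanUVNodes.N15KingModelRung.Covariant (covLapF)
open Summit.QuantumFields.YangMills.BalabanUVNodes.N15KingModelRung.CovariantBlock (BlockTree fullOpU effLapU)
open Summit.QuantumFields.YangMills.BalabanUVNodes.N15KingModelRung.FreeField (gaussNorm)

/-! ## §1 King's `E₀ = ln 𝒩(Δ_eff)` to second order -/

section GaussNorm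

variable {d : ℕ} {L : ℕ} [NeZero L] (T : BlockTree d L) (M : Fin (d + 1) → ℕ) [hM : ∀ μ, NeZero (M μ)]
variable {n : Type*} [Fintype n] [DecidableEq n] [Nonempty n]
variable {a c m2 : ℝ} (ha : 0 < a) (hc : 0 ≤ c) (hm : 0 < m2)
variable {U V : Tor (fine L M) × Fin (d + 1) → Matrix n n ℝ} (hU : ∀ bd, U bd ∈ Matrix.unitaryGroup n ℝ) (hV : ∀ bd, V bd ∈ Matrix.unitaryGroup n ℝ)
include ha hc hm hU hV

/-- ★★★ **KING's `E₀ = ln 𝒩(Δ_eff)` ((3.89)) TO SECOND ORDER IN THE BACKGROUND OPERATOR**: with `C(V) = Δ_eff(V)⁻¹`, `E = Δ_eff(U) − Δ_eff(V)`, `β♯ = (a⁻¹+m⁻²)⁻¹`,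
`−½tr(C(V)E) + ¼a⁻²tr(E²) ≤ ln 𝒩(Δ_eff(U)) − ln 𝒩(Δ_eff(V)) ≤ −½tr(C(V)E) + ¼β♯⁻²tr(E²)` — the Gaussian normalisation is log-CONVEX along the operator segment with modulus in `[¼a⁻², ¼β♯⁻²]`
(`ln 𝒩 = ½N ln 2π − ½ ln det`, Ϭ-b, against Ϯ-h's two-sided (3.96)). [cite: King1986, (2.6) p.652, (3.89)–(3.90) pp.668–669, (3.96) p.669, (4.33) p.674] -/
theorem king_logGaussNorm_second_order :
    -(1 / 2) * ((effLapU T M a c m2 V)⁻¹ * (effLapU T M a c m2 U - effLapU T M a c m2 V)).trace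
          + 1 / 4 * a⁻¹ ^ 2 * ((effLapU T M a c m2 U - effLapU T M a c m2 V) * (effLapU T M a c m2 U - effLapU T M a c m2 V)).trace
        ≤ Real.log (gaussNorm (effLapU T M a c m2 U)) - Real.log (gaussNorm (effLapU T M a c m2 V))
      ∧ Real.log (gaussNorm (effLapU T M a c m2 U)) - Real.log (gaussNorm (effLapU T M a c m2 V))
        ≤ -(1 / 2) * ((effLapU T M a c m2 V)⁻¹ * (effLapU T M a c m2 U - effLapU T M a c m2 V)).trace
          + 1 / 4 * (a⁻¹ + m2⁻¹) ^ 2 * ((effLapU T M a c m2 U - effLapU T M a c m2 V) * (effLapU T M a c m2 U - effLapU T M a c m2 V)).trace := by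
  have h := king396_two_sided_remainder T M ha hc hm hU hV
  rw [log_gaussNorm_effLapU T M ha hc hm hU, log_gaussNorm_effLapU T M ha hc hm hV]
  constructor <;> linarith [h.1, h.2]

end GaussNorm

/-! ## §2 The second variation, packaged -/

section SecondVariation

variable {d : ℕ} {L : ℕ} [NeZero L] (T : BlockTree d L) (M : Fin (d + 1) → ℕ) [hM : ∀ μ, NeZero (M μ)]
variable {n : Type*} [Fintype n] [DecidableEq n] [Nonempty n]
variable {a c m2 : ℝ} (ha : 0 < a) (hc : 0 ≤ c) (hm : 0 < m2)
variable {U V : Tor (fine L M) × Fin (d + 1) → Matrix n n ℝ} (hU : ∀ bd, U bd ∈ Matrix.unitaryGroup n ℝ) (hV : ∀ bd, V bd ∈ Matrix.unitaryGroup n ℝ)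
include ha hc hm hU hV

/-- ★★★★ **KING's (3.96) AT `n = 2` FOR THE BLOCK-FIELD NORMALISATION, PACKAGED** (`Δ_t = Δ_eff(V) + tE`, `E = Δ_eff(U) − Δ_eff(V)`, `C = Δ_eff⁻¹`, `β♯ = (a⁻¹+m⁻²)⁻¹`, any two real-orthogonal
backgrounds): (i) the curvature `∂_t² ln det Δ_t = −tr(Δ_t⁻¹EΔ_t⁻¹E) ∈ [−β♯⁻²tr(E²), −a⁻²tr(E²)]` on `[0,1]` (Ϯ-g); (ii) two-sided Taylor `tr(C(V)E) − ½β♯⁻²tr(E²) ≤ Δ ln det ≤ tr(C(V)E) − ½a⁻²tr(E²)`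
(Ϯ-h); (iii) the strong sandwich `tr(C(U)E) + ½a⁻²tr(E²) ≤ Δ ln det` (Ϯ-h); (iv) the exact formula `Δ ln det = tr(C(V)E) − ∫₀¹(1−t)tr(Δ_t⁻¹EΔ_t⁻¹E)dt` (Ϯ-i).
[cite: King1986, (3.94)–(3.96) p.669, (3.89)–(3.90) pp.668–669, (2.14) p.653, (4.33) p.674; Klingen1990, Ch. V §11 (15) p.141] -/
theorem king_second_variation_package :
    (∀ t ∈ Icc (0 : ℝ) 1,
        -((a⁻¹ + m2⁻¹) ^ 2 * ((effLapU T M a c m2 U - effLapU T M a c m2 V) * (effLapU T M a c m2 U - effLapU T M a c m2 V)).trace)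
            ≤ -((effLapU T M a c m2 V + t • (effLapU T M a c m2 U - effLapU T M a c m2 V))⁻¹ * (effLapU T M a c m2 U - effLapU T M a c m2 V)
                * (effLapU T M a c m2 V + t • (effLapU T M a c m2 U - effLapU T M a c m2 V))⁻¹ * (effLapU T M a c m2 U - effLapU T M a c m2 V)).trace
          ∧ -((effLapU T M a c m2 V + t • (effLapU T M a c m2 U - effLapU T M a c m2 V))⁻¹ * (effLapU T M a c m2 U - effLapU T M a c m2 V)
                * (effLapU T M a c m2 V + t • (effLapU T M a c m2 U - effLapU T M a c m2 V))⁻¹ * (effLapU T M a c m2 U - effLapU T M a c m2 V)).trace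
            ≤ -(a⁻¹ ^ 2 * ((effLapU T M a c m2 U - effLapU T M a c m2 V) * (effLapU T M a c m2 U - effLapU T M a c m2 V)).trace))
    ∧ (((effLapU T M a c m2 V)⁻¹ * (effLapU T M a c m2 U - effLapU T M a c m2 V)).trace
          - 1 / 2 * (a⁻¹ + m2⁻¹) ^ 2 * ((effLapU T M a c m2 U - effLapU T M a c m2 V) * (effLapU T M a c m2 U - effLapU T M a c m2 V)).trace
        ≤ Real.log (effLapU T M a c m2 U).det - Real.log (effLapU T M a c m2 V).det
      ∧ Real.log (effLapU T M a c m2 U).det - Real.log (effLapU T M a c m2 V).det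
        ≤ ((effLapU T M a c m2 V)⁻¹ * (effLapU T M a c m2 U - effLapU T M a c m2 V)).trace
          - 1 / 2 * a⁻¹ ^ 2 * ((effLapU T M a c m2 U - effLapU T M a c m2 V) * (effLapU T M a c m2 U - effLapU T M a c m2 V)).trace)
    ∧ ((effLapU T M a c m2 U)⁻¹ * (effLapU T M a c m2 U - effLapU T M a c m2 V)).trace
          + 1 / 2 * a⁻¹ ^ 2 * ((effLapU T M a c m2 U - effLapU T M a c m2 V) * (effLapU T M a c m2 U - effLapU T M a c m2 V)).trace
        ≤ Real.log (effLapU T M a c m2 U).det - Real.log (effLapU T M a c m2 V).det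
    ∧ Real.log (effLapU T M a c m2 U).det - Real.log (effLapU T M a c m2 V).det
      = ((effLapU T M a c m2 V)⁻¹ * (effLapU T M a c m2 U - effLapU T M a c m2 V)).trace
        - ∫ t in (0 : ℝ)..1, (1 - t) * ((effLapU T M a c m2 V + t • (effLapU T M a c m2 U - effLapU T M a c m2 V))⁻¹ * (effLapU T M a c m2 U - effLapU T M a c m2 V)
            * (effLapU T M a c m2 V + t • (effLapU T M a c m2 U - effLapU T M a c m2 V))⁻¹ * (effLapU T M a c m2 U - effLapU T M a c m2 V)).trace :=
  ⟨fun _ ht => king_second_variation_bounds T M ha hc hm hU hV ht, king396_two_sided_remainder T M ha hc hm hU hV,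
    (king_response_sandwich_strong T M ha hc hm hU hV).1, log_det_effLapU_sub_eq_trace_sub_integral T M ha hc hm hU hV⟩

end SecondVariation

/-! ## §3 Locality, packaged (`d+1 = 4`, King's scaling) -/

section Locality

variable {L : ℕ} [NeZero L] (T : BlockTree 3 L) (M₀ : ℕ) [NeZero M₀]
variable {𝕜 : Type*} [RCLike 𝕜] {n : Type*} [Fintype n] [DecidableEq n]
variable {a m2 : ℝ} (ha : 0 < a) (hm : 0 < m2)
variable {U V : Tor (fine L (cM M₀)) × Fin (3 + 1) → Matrix n n 𝕜} (hU : ∀ bd, U bd ∈ Matrix.unitaryGroup n 𝕜) (hV : ∀ bd, V bd ∈ Matrix.unitaryGroup n 𝕜)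
include ha hm hU hV

/-- ★★★★ **LOCALITY OF NE2's UNIT-LAYER NORMALISATION, PACKAGED** (`d+1 = 4`, `c = L²`, every `L, M₀ ≥ 1`, every tree contour system, any `RCLike` fibre): (i) backgrounds agreeing off `Z`:
`|ln det Δ_eff(U) − ln det Δ_eff(V)| ≤ (10|n|² + (8|n|²+a|n|)∕m²)·#Z` (Ϯ-f); (ii) never more than Ϭ-b's global `N·ln(1+a∕m²)`; (iii) a background trivial off `Z` deviates from King's closed form
`|n|Σ_q ln effSym(q)` by at most `(10|n|² + (8|n|²+a|n|)∕m²)·#Z` (Ϯ-f); (iv) the coincident-point bound behind the uniformity `L²G(0,0) ≤ 5∕4 + 1∕m²` (Ϯ-e).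
[cite: King1986, (2.13)–(2.16) p.653, (3.89)–(3.90) pp.668–669, (4.4)–(4.5) p.670, (4.33)∕(4.35) p.674; Balaban1985BackgroundPropagators, (3.19) p.393, (3.23)–(3.25) p.394, (3.42) p.397] -/
theorem king_locality_package {Z : Finset (Tor (fine L (cM M₀)) × Fin (3 + 1))} (hZ : ∀ bd, bd ∉ Z → U bd = V bd) :
    |Real.log (RCLike.re (effLapU T (cM M₀) a ((L : ℝ) ^ 2) m2 U).det) - Real.log (RCLike.re (effLapU T (cM M₀) a ((L : ℝ) ^ 2) m2 V).det)|
        ≤ (10 * (Fintype.card n : ℝ) ^ 2 + (8 * (Fintype.card n : ℝ) ^ 2 + a * (Fintype.card n : ℝ)) * m2⁻¹) * Z.card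
    ∧ |Real.log (RCLike.re (effLapU T (cM M₀) a ((L : ℝ) ^ 2) m2 U).det) - Real.log (RCLike.re (effLapU T (cM M₀) a ((L : ℝ) ^ 2) m2 V).det)|
        ≤ Fintype.card (Tor (cM M₀) × n) * Real.log (1 + a / m2)
    ∧ ((∀ bd, bd ∉ Z → U bd = 1) →
        |Real.log (RCLike.re (effLapU T (cM M₀) a ((L : ℝ) ^ 2) m2 U).det) - Fintype.card n * ∑ q : Tor (cM M₀), Real.log (effSym L (cM M₀) a ((L : ℝ) ^ 2) m2 q)|
          ≤ (10 * (Fintype.card n : ℝ) ^ 2 + (8 * (Fintype.card n : ℝ) ^ 2 + a * (Fintype.card n : ℝ)) * m2⁻¹) * Z.card)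
    ∧ (L : ℝ) ^ 2 * (lapF (fine L (cM M₀)) ((L : ℝ) ^ 2) m2)⁻¹ 0 0 ≤ 5 / 4 + m2⁻¹ :=
  ⟨abs_log_re_det_effLapU_sub_le_volume_eta_uniform T M₀ hm hU hV ha hZ, abs_log_re_det_effLapU_sub_le T (cM M₀) ha (by positivity) hm hU hV,
    fun hZ1 => abs_log_re_det_effLapU_sub_closedForm_le_volume_eta_uniform T M₀ hm hU ha hZ1, king_green_diag_eta_uniform' L M₀ hm 0⟩

end Locality

/-! ## §4 What the curved case adds -/

section Curved

variable {L : ℕ} [NeZero L] (T : BlockTree 3 L) (M₀ : ℕ) [NeZero M₀]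
variable {n : Type*} [Fintype n] [DecidableEq n] [Nonempty n]
variable {a m2 : ℝ} (ha : 0 < a) (hm : 0 < m2)
include ha hm

/-- ★★★ **WHAT THE CURVED CASE ADDS TO NE2's UNIT-LAYER NORMALISATION — PART Ϯ IN ONE STATEMENT** (`d+1 = 4`, King's scaling `c = L²`, real-orthogonal backgrounds; every `L, M₀ ≥ 1`, every tree
contour system): at `U ≡ 1` King's closed form holds EXACTLY (Ϭ-i) and every item below is `0 ≤ 0`; at a curved background (i) a change of the background on a bond set `Z` moves
`ln det Δ_eff` by at most `(10|n|² + (8|n|²+a|n|)∕m²)·#Z`, uniformly in the spacing (the 4-d walk is transient); (ii) between two backgrounds with DISTINCT block-field operators the vacuum energy is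
STRICTLY concave with modulus `a⁻²`: `ln det Δ_eff(U) − ln det Δ_eff(V) ≤ tr(C(V)E) − ½a⁻²tr(E²) < tr(C(V)E)`; (iii) two changes on disjoint bond sets `Z₁, Z₂` at torus distance `≥ D` interact,
in the fine normalisation `ln det(−L²Δ_U + m²)`, by at most `16L⁴|n|⁴[(2∕m²)C_per(κ_F)e^{−κ_F D∕4}]²·#Z₁#Z₂` (King's decay rate `κ_F = kappaFree L² m² 3`).
[cite: King1986, (2.13)–(2.16) p.653, (3.89)–(3.90) pp.668–669, (3.94)–(3.96) p.669, (4.4)–(4.5) p.670, (4.33)∕(4.35)∕(4.38) p.674; Balaban1985BackgroundPropagators, (3.19) p.393, (3.23)–(3.25) p.394,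
(3.42) p.397, Thm 3.4 p.400; Klingen1990, Ch. V §11 (15) p.141] -/
theorem king_locality_what_the_curved_case_adds
    {U V : Tor (fine L (cM M₀)) × Fin (3 + 1) → Matrix n n ℝ} (hU : ∀ bd, U bd ∈ Matrix.unitaryGroup n ℝ) (hV : ∀ bd, V bd ∈ Matrix.unitaryGroup n ℝ)
    {Z : Finset (Tor (fine L (cM M₀)) × Fin (3 + 1))} (hZ : ∀ bd, bd ∉ Z → U bd = V bd)
    {U₀ U₁ U₂ : Tor (fine L (cM M₀)) × Fin (3 + 1) → Matrix n n ℝ} (hU₀ : ∀ b, U₀ b ∈ Matrix.unitaryGroup n ℝ) (hU₁ : ∀ b, U₁ b ∈ Matrix.unitaryGroup n ℝ)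
    (hU₂ : ∀ b, U₂ b ∈ Matrix.unitaryGroup n ℝ) {Z₁ Z₂ : Finset (Tor (fine L (cM M₀)) × Fin (3 + 1))} (h₁ : ∀ b, b ∉ Z₁ → U₁ b = U₀ b) (h₂ : ∀ b, b ∉ Z₂ → U₂ b = U₀ b)
    (hZ₁₂ : Disjoint Z₁ Z₂) {D : ℝ}
    (hsep : ∀ x y : Tor (fine L (cM M₀)), (∃ b ∈ Z₁, x = b.1 ∨ x = b.1 + unitVec (fine L (cM M₀)) b.2) → (∃ b ∈ Z₂, y = b.1 ∨ y = b.1 + unitVec (fine L (cM M₀)) b.2) →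
      D ≤ tdistT (fine L (cM M₀)) x y) :
    |Real.log (effLapU T (cM M₀) a ((L : ℝ) ^ 2) m2 U).det - Real.log (effLapU T (cM M₀) a ((L : ℝ) ^ 2) m2 V).det|
        ≤ (10 * (Fintype.card n : ℝ) ^ 2 + (8 * (Fintype.card n : ℝ) ^ 2 + a * (Fintype.card n : ℝ)) * m2⁻¹) * Z.card
    ∧ (effLapU T (cM M₀) a ((L : ℝ) ^ 2) m2 U ≠ effLapU T (cM M₀) a ((L : ℝ) ^ 2) m2 V →
        Real.log (effLapU T (cM M₀) a ((L : ℝ) ^ 2) m2 U).det - Real.log (effLapU T (cM M₀) a ((L : ℝ) ^ 2) m2 V).det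
          < ((effLapU T (cM M₀) a ((L : ℝ) ^ 2) m2 V)⁻¹ * (effLapU T (cM M₀) a ((L : ℝ) ^ 2) m2 U - effLapU T (cM M₀) a ((L : ℝ) ^ 2) m2 V)).trace)
    ∧ |Real.log (covLapF (fine L (cM M₀)) ((L : ℝ) ^ 2) m2 (U₁ + U₂ - U₀)).det - Real.log (covLapF (fine L (cM M₀)) ((L : ℝ) ^ 2) m2 U₁).det
          - Real.log (covLapF (fine L (cM M₀)) ((L : ℝ) ^ 2) m2 U₂).det + Real.log (covLapF (fine L (cM M₀)) ((L : ℝ) ^ 2) m2 U₀).det|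
        ≤ 16 * ((L : ℝ) ^ 2) ^ 2 * (Fintype.card n : ℝ) ^ 4
          * (2 / m2 * periodConst (kappaFree ((L : ℝ) ^ 2) m2 3) 3 * Real.exp (-(kappaFree ((L : ℝ) ^ 2) m2 3 / (3 + 1) * D))) ^ 2 * Z₁.card * Z₂.card := by
  refine ⟨?_, fun hne => log_det_effLapU_sub_lt_re_trace T (cM M₀) ha (by positivity) hm hU hV hne, ?_⟩
  · have h := abs_log_re_det_effLapU_sub_le_volume_eta_uniform T M₀ hm hU hV ha hZ
    simpa only [RCLike.re_to_real] using h
  · have h := abs_log_det_covLapF_decoupling (fine L (cM M₀)) (c := (L : ℝ) ^ 2) (by positivity) hm hU₀ hU₁ hU₂ h₁ h₂ hZ₁₂ hsep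
    norm_num at h ⊢
    exact h

end Curved

end Summit.QuantumFields.YangMills.BalabanUVNodes.N15KingModelRung.Analytic

end
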